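import Summits.BirchSwinnertonDyer.BirchSwinnertonDyer.Theorems.CumulativeHeegnerLeopoldtCumulativeHeegnerInclusionAtThreeB1OfPrint
import Summits.BirchSwinnertonDyer.BirchSwinnertonDyer.Theorems.CumulativeHeegnerLeopoldtCumulativeHeegnerInclusionAtThreeLineDeterminantAtThree
import Summits.BirchSwinnertonDyer.BirchSwinnertonDyer.Theorems.CumulativeHeegnerLeopoldtCumulativeHeegnerInclusionAtThreeBadPlacesSplitFinite
import Summits.BirchSwinnertonDyer.BirchSwinnertonDyer.Theorems.CumulativeHeegnerLeopoldtEisensteinCharacterInvariantsAtThreeAnyLine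
import Summits.BirchSwinnertonDyer.BirchSwinnertonDyer.Theorems.CumulativeHeegnerLeopoldtEisensteinCharacterInvariantsAtThreeLocThree
import Summits.BirchSwinnertonDyer.BirchSwinnertonDyer.Theorems.EisensteinPrimesResidualStrictEqUnramifiedChar
import Summits.BirchSwinnertonDyer.BirchSwinnertonDyer.Theorems.EisensteinPrimesResidualPairStableLine
import Summits.BirchSwinnertonDyer.BirchSwinnertonDyer.Theorems.EisensteinPrimesGoodLatticeMuLambdaSplit
import Literature.NumberTheory.EllipticCurves.HeegnerPointsKolyvaginCebotarevProofs
import Literature.NumberTheory.GaloisRepresentations.AbsIntegersEquiv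
import Summits.BirchSwinnertonDyer.BirchSwinnertonDyer.Theorems.SchneiderFreeAdditiveX3Defs
import Mathlib.NumberTheory.RamificationInertia.Unramified
import HarnessLib

/-!
# Route `CumulativeHeegnerLeopoldt`, crux K2 `EisensteinCharacterInvariantsAtThree` (stmt-BirchSwinnertonDyer-24199),
# line `birth` v4: the stub `stub_ramifiedResidualFinite` FROM PRINT (CGLS 2022 Prop. 14) — helper `--supports 24199`

Lead prover `bsd-line-chl-p1` g9. The residual half of [BRram] (v4 stub `stub_ramifiedResidualFinite`): on the
Leopoldt cell, for the 3-RAMIFIED member `θram` of the Teichmüller pair of a rational `3`-line, the `3`-torsion of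
Keller–Yin's unramified-at-`𝔭′` Selmer group `H¹_{𝓕_nr}(K_∞, (F/𝒪)(θram|_{Γ_K}))` is finite. PROVED here from the
route's PRINT item 26897 (`CastellaGrossiLeeSkinner2022.prop14_residualCharacterSelmer_finite`, displayed as `hP`):

1. the cell clause holds for the given line `Φ` (`…AnyLine.cellClause_of_cellClause`, p687106);
2. the residual pair over `K` has a stable line `S ≤ E_K[3]` with equivariant embeddings `S.Sub ↪ (F/𝒪)(θsub|K)`,
   `S.Quot ↪ (F/𝒪)(θquot|K)` onto the `3`-torsion (K5: `ResidualPairStableLine.exists_stableLine_of_isResidualPairOver`);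
3. the side hypotheses of Prop. 14 for `S.Sub`, `S.Quot` exactly as in the K1 lineage's B1 port (p616187:
   `…B1OfPrint`, `…LineDeterminantAtThree`, `…BadPlacesSplitFinite`), the non-anomalous clauses for THIS `S` being
   read off the characters through the embeddings (`θ(res g) ≠ 1` for some `g ∈ decomp 𝔭′`, and
   `CharResidualSelmerCount.eq_zero_of_smul_eq_of_hom`);
4. Prop. 14 ⟹ the residual STRICT groups of `S.Sub`, `S.Quot` at `𝔭′` are finite;
5. `θram` is ramified at `𝔭′` in the `K`-side currency (`τ ∈ GreenbergSelmer.inertia 𝔭′` with `unitChar ≠ 1`): over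
   `ℚ` the product `θsub θquot = ω̃` is ramified at `3` while `θunr` is not (as in p682321); the inertia element lifts
   along `res : Γ_K → Γ_ℚ` (`3` unramified in `K`, `inertia_le_range_absGaloisRestrict_of_isUnramifiedIn`) into the
   chosen inertia group (`comap_inertia_comap_absIntegersMap`, `inertia_adicCompletionPrime_eq_map_absInertia`);
6. hence strict = unramified for the `θram`-line (K5: `grSelmer_eq_unrSelmer_of_hom_of_ramified`), the primitive
   group embeds in the imprimitive one (`unrSelmer_mono`), and Kummer (K5: `natCard_unrSelmer_eq_natCard_pTorsion`)
   transports finiteness to `H¹_{𝓕_nr}(K_∞, (F/𝒪)(θram|K))[3]`.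

THEOREMS ONLY; CONDITIONAL on the print fact `hP`; closes nothing by itself. BSD is not proved for any curve by this.
References: [CastellaGrossiLeeSkinner2022] §1.2 Prop. 14, Lemma 13; [KellerYin2024] Lemma 1.2.4, §1.3;
[NeukirchANT1999] Ch. I §9; [GreenbergVatsal2000] §2.
-/

set_option autoImplicit false
-- `…BirchSwinnertonDyer.BirchSwinnertonDyer.Theorems…` is the problem's mandated namespace (D-0017).
set_option linter.dupNamespace false

noncomputable section

open scoped Classical

namespace Summit.BirchSwinnertonDyer.BirchSwinnertonDyer.Theorems.EisensteinCharacterInvariantsAtThreeRamifiedResidual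

open NumberField IsDedekindDomain Field WeierstrassCurve
open Literature.NumberTheory.EllipticCurves Literature.NumberTheory.EllipticCurves.GreenbergSelmer
  Literature.NumberTheory.EllipticCurves.GreenbergVatsal2000
  Literature.NumberTheory.GaloisRepresentations IsDedekindDomain.HeightOneSpectrum
  Literature.NumberTheory.EllipticCurves.Rank1Residual
  Literature.NumberTheory.EllipticCurves.KellerYin2024
  Summit.BirchSwinnertonDyer.Rank1Residual.X11b Summit.BirchSwinnertonDyer.Rank1Residual.X11b.AcSelmer
  Summit.BirchSwinnertonDyer.Rank1Residual.X2.ResidualDevissageModules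
  Summit.BirchSwinnertonDyer.Rank1Residual.X2.PrimeOrderCharacters
  Summit.BirchSwinnertonDyer.BirchSwinnertonDyer.Theorems.CumulativeHeegnerInclusionAtThreeResidualDevissage
  Summit.BirchSwinnertonDyer.BirchSwinnertonDyer.Theorems.CumulativeHeegnerInclusionAtThreeLineBaseChange
  Summit.BirchSwinnertonDyer.BirchSwinnertonDyer.Theorems.AdditiveKoly.SplitCompletion
  Summit.BirchSwinnertonDyer.BirchSwinnertonDyer.Theorems.EisensteinPrimesMuLambda
  Summit.BirchSwinnertonDyer.BirchSwinnertonDyer.Theorems.CharResidualSelmerCount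

/-- **`stub_ramifiedResidualFinite` from print.** `hP` = CGLS 2022 Prop. 14 (route item 26897, Literature named
fact; unproved published input). Conclusion = the v4 registered stub `stub_ramifiedResidualFinite` VERBATIM: on the
Leopoldt cell, for every rational `3`-line `Φ`, Teichmüller pair `(θsub, θquot)` on it and labelling
`(θunr, θram)` with `θunr` unramified at `3`, the set `{s ∈ H¹_{𝓕_nr}(K_∞, (F/𝒪)(θram|_{Γ_K})) | 3·s = 0}`
(Keller–Yin's `unrSelmer κ · 𝔭′ ∅`) is finite. CONDITIONAL on `hP`; closes nothing by itself.
[cite: CastellaGrossiLeeSkinner2022, §1.2 Prop. 14 and Lemma 13 (arXiv:2008.02571)]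
[cite: KellerYin2024, Lemma 1.2.4 and §1.3 (arXiv:2402.12781v2)] -/
theorem ramifiedResidualFinite_of_print
    (hP : Literature.NumberTheory.EllipticCurves.CastellaGrossiLeeSkinner2022.prop14_residualCharacterSelmer_finite) :
    ∀ (W : WeierstrassCurve ℚ) [W.IsElliptic] [W.IsGloballyMinimal] (N : ℕ) [NeZero N] (K : Type) [Field K] [NumberField K], Summit.BirchSwinnertonDyer.Rank1Residual.Additive.ClassO6 W 3 → Literature.NumberTheory.EllipticCurves.Rank1Residual.Red W 3 → (∃ Φ : AddSubgroup (WeierstrassCurve.geomTorsion W ((3 : ℕ) : ℤ)), Literature.NumberTheory.EllipticCurves.Rank1Residual.IsRationalLine W 3 Φ ∧ ∀ (v : IsDedekindDomain.HeightOneSpectrum (NumberField.RingOfIntegers ℚ)), ((3 : ℕ) : NumberField.RingOfIntegers ℚ) ∈ v.asIdeal → ∀ 𝔓 ∈ v.primesAbove, ¬ (∀ g ∈ 𝔓.decompositionSubgroup (Field.absoluteGaloisGroup ℚ), ∀ P ∈ Φ, g • P = P) ∧ ¬ (∀ g ∈ 𝔓.decompositionSubgroup (Field.absoluteGaloisGroup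 ℚ), ∀ P : WeierstrassCurve.geomTorsion W ((3 : ℕ) : ℤ), g • P - P ∈ Φ)) → W.conductorNorm ℤ = N → Literature.NumberTheory.EllipticCurves.IsImaginaryQuadratic K → Literature.NumberTheory.EllipticCurves.SatisfiesHeegnerHypothesis N K → Odd (NumberField.discr K) → (∀ Q : (W.baseChange K).toAffine.Point, (3 : ℕ) • Q = 0 → Q = 0) → ∀ (κ : Literature.NumberTheory.EllipticCurves.ZpExtension K 3), κ.IsAnticyclotomic → ∀ (γ : Field.absoluteGaloisGroup K) [Fact (κ.IsTopGenerator γ)] (𝔭 : IsDedekindDomain.HeightOneSpectrum (NumberField.RingOfIntegers K)), ((3 : ℕ) : NumberField.RingOfIntegers K) ∈ 𝔭.asIdeal → 𝔭.asIdeal.ramificationIdx (NumberField.RingOfIntegers ℚ) = 1 → 𝔭.asIdeal.inertiaDeg (NumberField.RingOfIntegers ℚ) = 1 → ∀ (𝔭' : IsDedekindDomain.HeightOneSpectrum (NumberField.RingOfIntegers K)), ((3 : ℕ) : NumberField.RingOfIntegers K) ∈ 𝔭'.asIdeal → 𝔭' ≠ 𝔭 → ∀ (ι' : PadicAlgCl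 3 ≃+* ℂ), Summit.BirchSwinnertonDyer.BirchSwinnertonDyer.Theorems.SchneiderFree.BranchInducesPrime 3 ι' 𝔭 → ∀ (Φ : AddSubgroup (WeierstrassCurve.geomTorsion W ((3 : ℕ) : ℤ))), Literature.NumberTheory.EllipticCurves.Rank1Residual.IsRationalLine W 3 Φ → ∀ (θsub θquot : FramedGaloisRep ℚ (padicCoeffIntegers (∅ : Set (PadicAlgCl 3))) 1), Literature.NumberTheory.EllipticCurves.KellerYin2024.IsTeichmullerLiftOn (∅ : Set (PadicAlgCl 3)) (Φ.map (WeierstrassCurve.geomTorsion W ((3 : ℕ) : ℤ)).subtype) θsub → Literature.NumberTheory.EllipticCurves.KellerYin2024.IsTeichmullerLiftOnQuot (∅ : Set (PadicAlgCl 3)) (Φ.map (WeierstrassCurve.geomTorsion W ((3 : ℕ) : ℤ)).subtype) (WeierstrassCurve.geomTorsion W ((3 : ℕ) : ℤ)) θquot → ∀ (θunr θram : FramedGaloisRep ℚ (padicCoeffIntegers (∅ : Set (PadicAlgCl 3))) 1), ((θunr = θsub ∧ θram = θquot) ∨ (θunr = θquot ∧ θram = θsub)) → (∀ u : IsDedekindDomain.HeightOneSpectrum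 (NumberField.RingOfIntegers ℚ), ((3 : ℕ) : NumberField.RingOfIntegers ℚ) ∈ u.asIdeal → θunr.IsUnramifiedAt u) → Set.Finite {s : Literature.NumberTheory.EllipticCurves.KellerYin2024.unrSelmer κ (Literature.NumberTheory.EllipticCurves.KellerYin2024.charModule (∅ : Set (PadicAlgCl 3)) (θram.restrictField K)) 𝔭' (∅ : Set (IsDedekindDomain.HeightOneSpectrum (NumberField.RingOfIntegers K))) | (3 : ℕ) • s = 0} := by
  intro W _ _ N _ K _ _ hO6 hRed hcell hN hK hHN _hodd _hEK κ hκ γ _ 𝔭 _h𝔭 _he _hf 𝔭' h𝔭' _hne _ι' _hι Φ hΦ θsub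
    θquot hsub hquot θunr θram hpr hunr
  obtain ⟨Φ₀, hΦ₀, hcell₀⟩ := hcell
  have hcellΦ := EisensteinCharacterInvariantsAtThreeAnyLine.cellClause_of_cellClause W 3 hΦ₀ hΦ hcell₀
  haveI : Fact (Nat.Prime 3) := ⟨Nat.prime_three⟩
  haveI hEKi : (W.baseChange K).IsElliptic := inferInstanceAs (W.map (algebraMap ℚ K)).IsElliptic
  haveI : IsGalois ℚ K := isGalois_of_finrank_eq_two K hK.1
  /- `3 ∣ N` splits in `K`; `𝔭′` has degree one -/
  have h3N : 3 ∣ N := by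
    rw [← hN]; exact (W.dvd_conductorNorm_iff_not_hasGoodReductionAtPrime 3).mpr hO6.2.1.1
  have hsplit : ((Ideal.span {((3 : ℕ) : ℤ)}).primesOver (𝓞 K)).ncard = 2 := hHN 3 Nat.prime_three h3N
  have he' : 𝔭'.asIdeal.ramificationIdx (𝓞 ℚ) = 1 := ramificationIdx_eq_one_of_card_primesOver K 3 hK.1 hsplit 𝔭' h𝔭'
  have hf' : 𝔭'.asIdeal.inertiaDeg (𝓞 ℚ) = 1 := inertiaDeg_eq_one_of_card_primesOver K 3 hK.1 hsplit 𝔭' h𝔭'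
  set v₃ : HeightOneSpectrum (𝓞 ℚ) := 𝔭'.under (𝓞 ℚ) with hv₃
  have hw : 𝔭'.asIdeal.under (𝓞 ℚ) = v₃.asIdeal := by rw [hv₃, HeightOneSpectrum.under_asIdeal]
  have h3v : ((3 : ℕ) : 𝓞 ℚ) ∈ v₃.asIdeal := natCast_mem_under K 3 𝔭' h𝔭'
  have hcellv := hcellΦ v₃ h3v
  /- the residual pair over `K` and its stable line with the two embeddings -/
  have hpair : IsResidualPairOver (W.baseChange K) 3 (θsub.restrictField K) (θquot.restrictField K) :=
    isResidualPairOver_restrictField W 3 K hΦ hsub hquot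
  obtain ⟨S, hSub, hQuot, ⟨jS, hjS, hinjS, hrS⟩, ⟨jQ, hjQ, hinjQ, hrQ⟩⟩ :=
    ResidualPairStableLine.exists_stableLine_of_isResidualPairOver (W.baseChange K) hpair
  have hTsK : ∀ σ : absoluteGaloisGroup K, θsub.restrictField K σ ^ (3 - 1) = 1 := fun σ ↦ hsub.1 _
  have hTqK : ∀ σ : absoluteGaloisGroup K, θquot.restrictField K σ ^ (3 - 1) = 1 := fun σ ↦ hquot.1 _
  /- unit-character plumbing: `unitChar θ' g = 1 → θ' g = 1` -/
  have hunit : ∀ (θ' : FramedGaloisRep K (padicCoeffIntegers (∅ : Set (PadicAlgCl 3))) 1) (g : absoluteGaloisGroup K),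
      unitChar θ' g = 1 → θ' g = 1 := by
    intro θ' g h1
    apply apply_eq_one_of_entry_eq_one (∅ : Set (PadicAlgCl 3)) θ' g
    change ((θ' g : GL (Fin 1) (padicCoeffIntegers (∅ : Set (PadicAlgCl 3)))) :
      Matrix (Fin 1) (Fin 1) (padicCoeffIntegers (∅ : Set (PadicAlgCl 3)))) 0 0 = 1
    rw [← padicIntEquiv_unitChar, h1, Units.val_one, map_one]
  /- elements of `decomp 𝔭′` on which the two characters are non-trivial (the cell clause for `Φ`) -/
  have hγsub : ∃ g ∈ decomp 𝔭', unitChar (θsub.restrictField K) g ≠ 1 := by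
    have hnon : ¬ ∀ γ ∈ decomp 𝔭', ∀ P ∈ Φ, absGaloisRestrict ℚ K γ • P = P :=
      not_forall_decomp_smul_eq K Φ hw he' hf' fun 𝔓 h𝔓 ↦ (hcellv 𝔓 h𝔓).1
    by_contra hall
    push Not at hall
    apply hnon
    intro γ hγ P hP
    have h1 : θsub (absGaloisRestrict ℚ K γ) = 1 := by
      rw [← FramedGaloisRep.restrictField_apply]; exact hunit _ _ (hall γ hγ)
    obtain ⟨a, ha, hΦa⟩ := hsub.exists_smul_eq (absGaloisRestrict ℚ K γ)
    have hea : ((entry (∅ : Set (PadicAlgCl 3)) θsub (absGaloisRestrict ℚ K γ) :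
        padicCoeffIntegers (∅ : Set (PadicAlgCl 3))) : PadicAlgCl 3) = 1 := by
      rw [entry_eq_one_of_apply_eq_one (∅ : Set (PadicAlgCl 3)) θsub h1, OneMemClass.coe_one]
    rw [hea, ← norm_neg, neg_sub, show (a : PadicAlgCl 3) - 1 = (((a - 1 : ℤ) : ℚ_[3]) : PadicAlgCl 3) by
      push_cast; rfl, PadicAlgCl.norm_extends, Padic.norm_intCast_lt_one_iff] at ha
    obtain ⟨c, hc⟩ := ha
    have hPp : ((3 : ℕ) : ℤ) • (P : geomPoints W) = 0 := (mem_geomTorsion_iff W _ _).mp P.2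
    have h := hΦa (P : geomPoints W) ⟨P, hP, rfl⟩
    rw [show a = 1 + c * ((3 : ℕ) : ℤ) by rw [mul_comm, ← hc]; ring, add_smul, one_smul, mul_smul, hPp,
      smul_zero, add_zero] at h
    exact Subtype.ext (by rw [AddSubgroup.torsionBy.coe_smul]; exact h)
  have hγquot : ∃ g ∈ decomp 𝔭', unitChar (θquot.restrictField K) g ≠ 1 := by
    have hnon : ¬ ∀ γ ∈ decomp 𝔭', ∀ P : W.geomTorsion ((3 : ℕ) : ℤ), absGaloisRestrict ℚ K γ • P - P ∈ Φ :=
      not_forall_decomp_smul_sub_mem K Φ hw he' hf' fun 𝔓 h𝔓 ↦ (hcellv 𝔓 h𝔓).2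
    by_contra hall
    push Not at hall
    apply hnon
    intro γ hγ P
    have h1 : θquot (absGaloisRestrict ℚ K γ) = 1 := by
      rw [← FramedGaloisRep.restrictField_apply]; exact hunit _ _ (hall γ hγ)
    obtain ⟨a, ha, hmem⟩ := hquot.2 (absGaloisRestrict ℚ K γ)
    have hea : ((entry (∅ : Set (PadicAlgCl 3)) θquot (absGaloisRestrict ℚ K γ) :
        padicCoeffIntegers (∅ : Set (PadicAlgCl 3))) : PadicAlgCl 3) = 1 := by
      rw [entry_eq_one_of_apply_eq_one (∅ : Set (PadicAlgCl 3)) θquot h1, OneMemClass.coe_one]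
    rw [hea, ← norm_neg, neg_sub, show (a : PadicAlgCl 3) - 1 = (((a - 1 : ℤ) : ℚ_[3]) : PadicAlgCl 3) by
      push_cast; rfl, PadicAlgCl.norm_extends, Padic.norm_intCast_lt_one_iff] at ha
    obtain ⟨c, hc⟩ := ha
    have hPp : ((3 : ℕ) : ℤ) • (P : geomPoints W) = 0 := (mem_geomTorsion_iff W _ _).mp P.2
    have haP : a • (P : geomPoints W) = P := by
      rw [show a = 1 + c * ((3 : ℕ) : ℤ) by rw [mul_comm, ← hc]; ring, add_smul, one_smul, mul_smul, hPp,
        smul_zero, add_zero]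
    obtain ⟨Q, hQ, hQeq⟩ := hmem (P : geomPoints W) P.2
    rw [haP] at hQeq
    have hPQ : absGaloisRestrict ℚ K γ • P - P = Q := by
      apply Subtype.ext
      rw [AddSubgroupClass.coe_sub, AddSubgroup.torsionBy.coe_smul, ← hQeq]
      rfl
    rw [hPQ]
    exact hQ
  /- the non-anomalous clauses for `S.Sub` / `S.Quot` through the embeddings -/
  have hSubne : ∃ m : S.Sub, m ≠ 0 := by
    by_contra h
    push Not at h
    haveI : Subsingleton S.Sub := ⟨fun a b ↦ by rw [h a, h b]⟩
    have : Nat.card S.Sub = 1 := Nat.card_of_subsingleton 0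
    rw [hSub] at this
    exact absurd this (by norm_num)
  have hQuotne : ∃ m : S.Quot, m ≠ 0 := by
    by_contra h
    push Not at h
    haveI : Subsingleton S.Quot := ⟨fun a b ↦ by rw [h a, h b]⟩
    have : Nat.card S.Quot = 1 := Nat.card_of_subsingleton 0
    rw [hQuot] at this
    exact absurd this (by norm_num)
  have hnon1 : ¬ ∀ γ ∈ decomp 𝔭', ∀ x : S.Sub, γ • x = x := by
    intro h
    obtain ⟨g, hg, hgne⟩ := hγsub
    obtain ⟨m, hm⟩ := hSubne
    exact hm (eq_zero_of_smul_eq_of_hom (θsub.restrictField K) hTsK jS hjS hinjS hgne (h g hg m))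
  have hnon2 : ¬ ∀ γ ∈ decomp 𝔭', ∀ y : S.Quot, γ • y = y := by
    intro h
    obtain ⟨g, hg, hgne⟩ := hγquot
    obtain ⟨m, hm⟩ := hQuotne
    exact hm (eq_zero_of_smul_eq_of_hom (θquot.restrictField K) hTqK jQ hjQ hinjQ hgne (h g hg m))
  /- CGLS's `θ|D ≠ ω` for both characters, from the determinant on the line (K1's port, p616187) -/
  have hdet := CumulativeHeegnerInclusionAtThreeLineDet.stub_lineDeterminantAtThree
  obtain ⟨χS, hχS⟩ := exists_character_of_natCard_eq (G := absoluteGaloisGroup K) (A := S.Sub) hSub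
  obtain ⟨χQ, hχQ⟩ := exists_character_of_natCard_eq (G := absoluteGaloisGroup K) (A := S.Quot) hQuot
  have hdetS := hdet K (W.baseChange K) S hSub
  have hωS : ¬ ∀ g ∈ decomp 𝔭', ∀ m : S.Sub,
      g • m = ((modNCyclotomicCharacter K 3 g : (ZMod 3)ˣ) : ZMod 3).val • m := by
    intro h
    apply hnon2
    intro g hg y
    have h1 := hdetS g ((modNCyclotomicCharacter K 3 g : (ZMod 3)ˣ) : ZMod 3).val
      ((χQ g : ZMod 3).val) (h g hg) (fun y ↦ hχQ g y)
    rw [Nat.cast_mul, ZMod.natCast_zmod_val, ZMod.natCast_zmod_val, mul_right_eq_self₀] at h1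
    rcases h1 with h1 | h1
    · rw [hχQ, h1, show ((1 : ZMod 3)).val = 1 from rfl, one_smul]
    · exact absurd h1 (modNCyclotomicCharacter K 3 g).ne_zero
  have hωQ : ¬ ∀ g ∈ decomp 𝔭', ∀ m : S.Quot,
      g • m = ((modNCyclotomicCharacter K 3 g : (ZMod 3)ˣ) : ZMod 3).val • m := by
    intro h
    apply hnon1
    intro g hg x
    have h1 := hdetS g ((χS g : ZMod 3).val)
      ((modNCyclotomicCharacter K 3 g : (ZMod 3)ˣ) : ZMod 3).val (fun x ↦ hχS g x) (h g hg)
    rw [Nat.cast_mul, ZMod.natCast_zmod_val, ZMod.natCast_zmod_val, mul_left_eq_self₀] at h1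
    rcases h1 with h1 | h1
    · rw [hχS, h1, show ((1 : ZMod 3)).val = 1 from rfl, one_smul]
    · exact absurd h1 (modNCyclotomicCharacter K 3 g).ne_zero
  /- the bad places prime to `3` and the unramified condition (K1's port, p616187 parts) -/
  set S₀ : Set (HeightOneSpectrum (𝓞 K)) :=
    {v | ((3 : ℕ) : 𝓞 K) ∉ v.asIdeal ∧ ¬ (W.baseChange K).HasGoodReductionAt v} with hS₀
  obtain ⟨hS₀fin, hS₀split⟩ := CumulativeHeegnerInclusionAtThreeBadPlaces.stub_badPlacesSplitFinite W N K hN hK hHN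
  have hgood : ∀ v : HeightOneSpectrum (𝓞 K), v ∉ S₀ → ((3 : ℕ) : 𝓞 K) ∉ v.asIdeal →
      (W.baseChange K).HasGoodReductionAt v := fun v hv h3 ↦ by
    by_contra hb
    exact hv ⟨h3, hb⟩
  have hS₀mem : ∀ v ∈ S₀, ((3 : ℕ) : 𝓞 K) ∉ v.asIdeal ∧ ((v.asIdeal.under ℤ).primesOver (𝓞 K)).ncard = 2 :=
    fun v hv ↦ ⟨hv.1, hS₀split v hv.1 hv.2⟩
  have hM : ∀ m : (W.baseChange K).geomTorsion ((3 : ℕ) : ℤ),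
      Continuous fun g : absoluteGaloisGroup K ↦ g • m :=
    continuous_smul_geomTorsion (W.baseChange K) ((3 : ℕ) : ℤ)
  have hunrE : ∀ v : HeightOneSpectrum (𝓞 K), v ∉ S₀ → ((3 : ℕ) : 𝓞 K) ∉ v.asIdeal →
      ∀ x ∈ inertia v, ∀ m : (W.baseChange K).geomTorsion ((3 : ℕ) : ℤ), x • m = m :=
    fun v hv h3 x hx m ↦ smul_geomTorsion_eq_of_mem_inertia_chosen (W.baseChange K) (hgood v hv h3) h3 hx m
  have hunrSub : ∀ v : HeightOneSpectrum (𝓞 K), v ∉ S₀ → ((3 : ℕ) : 𝓞 K) ∉ v.asIdeal →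
      ∀ x ∈ inertia v, ∀ m : S.Sub, x • m = m := fun v hv h3 x hx m ↦
    S.incl_injective (by rw [StableSubgroup.incl_smul]; exact hunrE v hv h3 x hx _)
  have hunrQuot : ∀ v : HeightOneSpectrum (𝓞 K), v ∉ S₀ → ((3 : ℕ) : 𝓞 K) ∉ v.asIdeal →
      ∀ x ∈ inertia v, ∀ m : S.Quot, x • m = m := fun v hv h3 x hx m ↦ by
    obtain ⟨n, rfl⟩ := S.proj_surjective m
    rw [StableSubgroup.smul_proj, hunrE v hv h3 x hx]
  /- CGLS Prop. 14 for the two residual modules: the STRICT residual groups at `𝔭′` are finite -/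
  have hΦfin : (datumStrictSelmer κ.kerSubgroup S.Sub 3 (AcSelmer.bdpData S.Sub 3 𝔭') S₀ :
      Set (Literature.NumberTheory.EllipticCurves.subgroupH1 κ.kerSubgroup S.Sub)).Finite :=
    hP K 3 hK (by norm_num) hsplit κ hκ 𝔭' h𝔭' S.Sub hSub (S.continuous_smul_sub hM) S₀ hS₀fin
      hS₀mem hunrSub hnon1 hωS
  have hΨfin : (datumStrictSelmer κ.kerSubgroup S.Quot 3 (AcSelmer.bdpData S.Quot 3 𝔭') S₀ :
      Set (Literature.NumberTheory.EllipticCurves.subgroupH1 κ.kerSubgroup S.Quot)).Finite :=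
    hP K 3 hK (by norm_num) hsplit κ hκ 𝔭' h𝔭' S.Quot hQuot (S.continuous_smul_quot hM) S₀ hS₀fin
      hS₀mem hunrQuot hnon2 hωQ
  /- `θram` is ramified at `𝔭′`: an element of the chosen inertia group with `unitChar ≠ 1` -/
  set 𝔓 : Ideal (absIntegers (𝓞 ℚ) ℚ) := (adicCompletionPrime K 𝔭').comap (absIntegersMap ℚ K) with h𝔓def
  have h𝔓 : 𝔓 ∈ v₃.primesAbove := comap_absIntegersMap_mem_primesAbove hw (adicCompletionPrime_mem_primesAbove K 𝔭')
  -- over `ℚ`: `θunr` trivial on `I_𝔓`, `θsub θquot = ω̃` non-trivial on `I_𝔓`, hence `θram τ₀ ≠ 1`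
  obtain ⟨τ₀, hτ₀I, hτ₀ne⟩ : ∃ τ₀ ∈ 𝔓.inertia (absoluteGaloisGroup ℚ), θram τ₀ ≠ 1 := by
    obtain ⟨τ, hτI, hτ⟩ := exists_mem_inertia_modPCyclotomicCharacterZMod_three_eq_neg_one h3v h𝔓
    refine ⟨τ, hτI, fun hram1 ↦ ?_⟩
    haveI : NeZero ((3 : ℕ) : ℚ) := ⟨by norm_num⟩
    have hcardΦ : Nat.card (Φ.map (geomTorsion W ((3 : ℕ) : ℤ)).subtype) = 3 := by
      rw [Nat.card_congr (Φ.equivMapOfInjective (geomTorsion W ((3 : ℕ) : ℤ)).subtype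
        (geomTorsion W ((3 : ℕ) : ℤ)).subtype_injective).toEquiv.symm, hΦ.1]
    have hleΦ : Φ.map (geomTorsion W ((3 : ℕ) : ℤ)).subtype ≤ geomTorsion W ((3 : ℕ) : ℤ) := by
      rintro P ⟨Q, -, rfl⟩
      exact Q.2
    have hdetT := entry_mul_entry_eq_teichmullerChar W (∅ : Set (PadicAlgCl 3)) hcardΦ hleΦ hsub hquot τ
    have hunr1 : θunr τ = 1 := hunr v₃ h3v 𝔓 h𝔓 τ hτI
    -- both entries are `1`, so `ω(-1) = 1`
    have hes : entry (∅ : Set (PadicAlgCl 3)) θsub τ = 1 := by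
      rcases hpr with ⟨h1, h2⟩ | ⟨h1, h2⟩
      · rw [← h1]; exact entry_eq_one_of_apply_eq_one _ θunr hunr1
      · rw [← h2]; exact entry_eq_one_of_apply_eq_one _ θram hram1
    have heq : entry (∅ : Set (PadicAlgCl 3)) θquot τ = 1 := by
      rcases hpr with ⟨h1, h2⟩ | ⟨h1, h2⟩
      · rw [← h2]; exact entry_eq_one_of_apply_eq_one _ θram hram1
      · rw [← h1]; exact entry_eq_one_of_apply_eq_one _ θunr hunr1
    rw [hes, heq, OneMemClass.coe_one, one_mul, hτ] at hdetT
    have h1 : ((Kato2004.teichmullerChar 3 (-1) : ℤ_[3]ˣ) : ℤ_[3]) = 1 := by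
      have h := (algebraMap ℚ_[3] (PadicAlgCl 3)).injective (hdetT.symm.trans (map_one _).symm)
      apply Subtype.val_injective
      rw [PadicInt.coe_one]
      exact h
    have h2 : ((-1 : (ZMod 3)ˣ) : ZMod 3) = 1 := by
      rw [← Kato2004.toZMod_teichmullerChar 3 (-1), h1, map_one]
    rw [Units.val_neg, Units.val_one] at h2
    exact EisensteinCharacterInvariantsAtThreeLocThree.neg_one_ne_one_zmod_three h2
  -- lift `τ₀` along `res : Γ_K → Γ_ℚ` (`3` is unramified in `K`) into the chosen inertia group at `𝔭′`
  have hunrK : Algebra.IsUnramifiedIn (𝓞 K) v₃.asIdeal := by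
    rw [Algebra.isUnramifiedIn_iff_forall_ramificationIdx_eq_one]
    intro Q _ hQ
    have hQ3 : ((3 : ℕ) : 𝓞 K) ∈ Q := by
      have : (algebraMap (𝓞 ℚ) (𝓞 K)) ((3 : ℕ) : 𝓞 ℚ) ∈ Q := by
        rw [← Ideal.mem_comap, ← Ideal.under_def, ← hQ.over]; exact h3v
      rwa [map_natCast] at this
    have hQne : Q ≠ ⊥ := by
      intro hb; rw [hb] at hQ3
      exact (by norm_num : ((3 : ℕ) : 𝓞 K) ≠ 0) ((Submodule.mem_bot (R := 𝓞 K)).mp hQ3)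
    let w : HeightOneSpectrum (𝓞 K) := ⟨Q, inferInstance, hQne⟩
    exact ramificationIdx_eq_one_of_card_primesOver K 3 hK.1 hsplit w hQ3
  obtain ⟨τ, hτ⟩ := inertia_le_range_absGaloisRestrict_of_isUnramifiedIn hunrK h𝔓 hτ₀I
  have hτ' : absGaloisRestrict ℚ K τ = τ₀ := hτ
  have hτI : τ ∈ inertia 𝔭' := by
    have h1 : τ ∈ (adicCompletionPrime K 𝔭').inertia (absoluteGaloisGroup K) := by
      rw [← comap_inertia_comap_absIntegersMap ℚ K (adicCompletionPrime K 𝔭'), Subgroup.mem_comap]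
      change absGaloisRestrict ℚ K τ ∈ 𝔓.inertia (absoluteGaloisGroup ℚ)
      rw [hτ']; exact hτ₀I
    rw [inertia_adicCompletionPrime_eq_map_absInertia K 𝔭'] at h1
    exact h1
  have hτne : unitChar (θram.restrictField K) τ ≠ 1 := by
    intro h1
    apply hτ₀ne
    rw [← hτ', ← FramedGaloisRep.restrictField_apply]
    exact hunit _ _ h1
  /- strict = unramified for the `θram`-line, and the Kummer transport -/
  have hempty : (∅ : Set (HeightOneSpectrum (𝓞 K))) ⊆ S₀ := Set.empty_subset _
  rcases hpr with ⟨-, h2⟩ | ⟨-, h2⟩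
  · -- `θram = θquot`: the quotient `S.Quot`
    rw [h2] at hτne ⊢
    have hgr : grSelmer κ S.Quot 𝔭' S₀ = unrSelmer κ S.Quot 𝔭' S₀ :=
      grSelmer_eq_unrSelmer_of_hom_of_ramified κ 𝔭' S₀ (θquot.restrictField K) hTqK jQ hjQ hinjQ hτI hτne
    have hfinS₀ : ((unrSelmer κ S.Quot 𝔭' S₀ : AddSubgroup _) :
        Set (Literature.NumberTheory.EllipticCurves.subgroupH1 κ.kerSubgroup S.Quot)).Finite := by
      rw [← hgr]; exact hΨfin
    have hfin0 : ((unrSelmer κ S.Quot 𝔭' (∅ : Set (HeightOneSpectrum (𝓞 K))) : AddSubgroup _) :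
        Set (Literature.NumberTheory.EllipticCurves.subgroupH1 κ.kerSubgroup S.Quot)).Finite :=
      hfinS₀.subset (unrSelmer_mono κ S.Quot 𝔭' hempty)
    haveI : Finite (unrSelmer κ S.Quot 𝔭' (∅ : Set (HeightOneSpectrum (𝓞 K)))) := hfin0.to_subtype
    have hcard := natCard_unrSelmer_eq_natCard_pTorsion (θquot.restrictField K) κ 𝔭'
      (∅ : Set (HeightOneSpectrum (𝓞 K))) hTqK jQ hjQ hinjQ hrQ
    have hne0 : Nat.card {s : unrSelmer κ (charModule (∅ : Set (PadicAlgCl 3)) (θquot.restrictField K)) 𝔭'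
        (∅ : Set (HeightOneSpectrum (𝓞 K))) // (3 : ℕ) • s = 0} ≠ 0 := by
      rw [← hcard]; exact Nat.card_pos.ne'
    exact Set.finite_coe_iff.mp (Nat.finite_of_card_ne_zero hne0)
  · -- `θram = θsub`: the line `S.Sub`
    rw [h2] at hτne ⊢
    have hgr : grSelmer κ S.Sub 𝔭' S₀ = unrSelmer κ S.Sub 𝔭' S₀ :=
      grSelmer_eq_unrSelmer_of_hom_of_ramified κ 𝔭' S₀ (θsub.restrictField K) hTsK jS hjS hinjS hτI hτne
    have hfinS₀ : ((unrSelmer κ S.Sub 𝔭' S₀ : AddSubgroup _) :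
        Set (Literature.NumberTheory.EllipticCurves.subgroupH1 κ.kerSubgroup S.Sub)).Finite := by
      rw [← hgr]; exact hΦfin
    have hfin0 : ((unrSelmer κ S.Sub 𝔭' (∅ : Set (HeightOneSpectrum (𝓞 K))) : AddSubgroup _) :
        Set (Literature.NumberTheory.EllipticCurves.subgroupH1 κ.kerSubgroup S.Sub)).Finite :=
      hfinS₀.subset (unrSelmer_mono κ S.Sub 𝔭' hempty)
    haveI : Finite (unrSelmer κ S.Sub 𝔭' (∅ : Set (HeightOneSpectrum (𝓞 K)))) := hfin0.to_subtype
    have hcard := natCard_unrSelmer_eq_natCard_pTorsion (θsub.restrictField K) κ 𝔭'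
      (∅ : Set (HeightOneSpectrum (𝓞 K))) hTsK jS hjS hinjS hrS
    have hne0 : Nat.card {s : unrSelmer κ (charModule (∅ : Set (PadicAlgCl 3)) (θsub.restrictField K)) 𝔭'
        (∅ : Set (HeightOneSpectrum (𝓞 K))) // (3 : ℕ) • s = 0} ≠ 0 := by
      rw [← hcard]; exact Nat.card_pos.ne'
    exact Set.finite_coe_iff.mp (Nat.finite_of_card_ne_zero hne0)

end Summit.BirchSwinnertonDyer.BirchSwinnertonDyer.Theorems.EisensteinCharacterInvariantsAtThreeRamifiedResidual

end
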